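import Summits.QuantumFields.YangMills.Theorems.FluctuationComparisonRegPrIntLS2BetaSecondOrderTowerSup
import HarnessLib

/-!
# S2β · row C-M «THE SIZE PROFILE OF THE RELATIVE TOWER» (K-UNIFORM, (130)-FORM): `‖X l c‖ ≤ Λ·L^l·‖X 0‖ + (second-order remainder)`, and under a
# quadratic one-step remainder and ONE top-level smallness, `‖X l c‖ ≤ 2·Λ·L^l·‖X 0‖` at EVERY level — over ✓p840433's segment-composite currency

Cell `ym3-torus` (YM ladder rung R3 = continuum `SU(2)` Yang–Mills on the three-torus at fixed lattice data — a RUNG: NOT d = 4, NOT infinite volume, NOT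
a mass gap, NOT Clay).  Width seat «width 20» `ym3-torus-px20` (gen 25), FREE px helper on crux `stmt-QuantumFields-20520`, LINE g18-1 S2β; row C-M named to
this seat by the desk (WORD №723 «px20 ‼ TAKE C-M», 2026-09-01T03:21:29Z, adopting this seat's 03:20:42Z COUNT: the C-word's straight-word pattern does NOT
transfer K-uniformly to RELATIVE variables — the relative correction factor carries the perturbed field's plaquette class and compounds `(1 + c∕L)^i`; the
K-uniform size profile is the composite road `M̄_l ≤ ‖D_{0→l}X₀‖ + ‖X_l − D_{0→l}X₀‖`).  `--kind proof --supports stmt-QuantumFields-20520 --as helper`,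
count-neutral, DEFINITION-FREE (0 `def`, 0 `instance`, 0 `notation`, 0 `sorry`, default heartbeats); ABSTRACT currency of ✓p840433 `…SecondOrderTowerSup`
VERBATIM (`X : (i:ℕ) → PBond P i → M_N`, one-step maps `Ds`, segment composites `Dseg i k`, segment sup constant `Λ`, letters `hsegadd hseg hsegsucc hsegkk`, `hr`).

WHAT IS PROVED (sorry-free).  §1 ★`norm_top_le_of_segment_letters (hX0 : ∀ b, ‖X 0 b‖ ≤ M₀) (c) : ‖X k c‖ ≤ Λ·L^k·M₀ + Σ_{i<k} Λ·L^{k−1−i}·r(i+1)` (segment row at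
`i = 0` + ✓`norm_sub_segment_le`).  §2 ★★`norm_le_of_segment_letters_all` — the same at EVERY `l ≤ k` (segment letters quantified over the top `l`).
§3 `geom_bootstrap_sum`; ★★★**`norm_le_two_mul_of_quadratic_remainder (hΛ : 1 ≤ Λ) (hC₂ : 0 ≤ C₂) (hM₀ : 0 ≤ M₀) (hL : 1 < L) (segment letters ∀ l ≤ k)
(hr2 : ∀ i < k, ∀ s, (∀ b, ‖X i b‖ ≤ s) → ∀ c, ‖X (i+1) c − Ds i (X i) c‖ ≤ C₂·s²) (hX0 : ∀ b, ‖X 0 b‖ ≤ M₀) (hsmall : 4·Λ²·C₂·L^k·M₀ ≤ L − 1) :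
∀ l ≤ k, ∀ c, ‖X l c‖ ≤ 2·Λ·L^l·M₀`** — the (130)-form «`|Q_j(U₀,A)| ≤ 2Lʲ|A|`» as a BOOTSTRAP (strong induction: `M̄_l ≤ ΛL^lM₀ + Σ_{i<l} ΛL^{l−1−i}·C₂·(2ΛL^iM₀)²`,
`(L−1)·Σ L^{l−1−i}L^{2i} ≤ L^{2l}`, and `4Λ²C₂M₀L^l ≤ L−1`), constant `2Λ` INDEPENDENT of the number of levels.
USE (row C-M for (P9)∕(O3-a), px12; (e) w4): instantiate at the S2β chart tower (`X i := ↑(X i ·)`), `Ds i := Dψ_i(0)`, `Dseg := ` the segment composites of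
✓`…ChartReadDescentChainRule`, `Λ := (1+4(d+2))e^{c₃Σα}` (✓(D2) ∕ ✓p840392∕✓p840499 (O2-b2)(′) segment rows), `C₂ :=` the one-step second-order constant (C₆∕C₇∕(D1)),
`M₀ := B₁s·η` ([Balaban1985RegularSpaces] Thm 2 (1.36) at the representative): **`M̄_l ≤ 2Λ·B₁s·L^l·η`** under the window `4Λ²C₂·B₁s ≤ L − 1` (`L^k·η = 1` at `k = K−J`).

HONEST SCOPE.  Triangle inequalities, a geometric sum and a strong induction over ✓p840433's abstract letters; nothing of Bałaban's renormalisation-group analysis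
is asserted or proved ([Balaban1985Averaging] Prop. 4 (130)–(131) p.37 is the printed row this packages); the instantiation letters ((D2)∕segment rows, `C₂`, (1.36))
are HYPOTHESES of the consumer; (O3-a), (REG-UP)′, GAP♯∘ (`stub_uniformFibreGapOrbit`, registry 3732b7df UNTOUCHED, 0∕5), the five registered stubs, S2β, crux 20520,
19936, 19200 and `YM3TorusSU2` are NOT proved; no registered stub is closed; rung R3 — NOT d = 4, NOT infinite volume, NOT a mass gap, NOT Clay; the Yang–Mills
mass gap is NOT proved.
-/

set_option autoImplicit false

noncomputable section

open scoped Matrix.Norms.L2Operator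

namespace Summit.QuantumFields.YangMills.Theorems.FluctuationComparisonRegPrIntLS2BetaRelativeSizeProfile

open Literature.MathematicalPhysics.QuantumFieldTheory.Balaban1983to89
open Summit.QuantumFields.YangMills.Theorems.FluctuationComparisonRegPrIntLS2BetaSecondOrderTowerSup (norm_sub_segment_le)

variable {P : Params} {N : ℕ}

/-! ## §1 The size at the top of a segment tower: linear part + second-order remainder -/

/-- ★ **THE SIZE AT THE TOP**: `‖X k c‖ ≤ Λ·L^k·M₀ + Σ_{i<k} Λ·L^{k−1−i}·r(i+1)` — the segment row at `i = 0` (`hseg`) plus ✓`norm_sub_segment_le`.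
[cite: Balaban1985Averaging, Prop. 4 (130)-(131) p.37] -/
theorem norm_top_le_of_segment_letters (k : ℕ) (X : (i : ℕ) → PBond P i → Matrix (Fin N) (Fin N) ℂ)
    (Ds : (i : ℕ) → (PBond P i → Matrix (Fin N) (Fin N) ℂ) → (PBond P (i + 1) → Matrix (Fin N) (Fin N) ℂ))
    (Dseg : (i k : ℕ) → (PBond P i → Matrix (Fin N) (Fin N) ℂ) → (PBond P k → Matrix (Fin N) (Fin N) ℂ))
    (Λ : ℝ) (r : ℕ → ℝ)
    (hsegadd : ∀ i, i ≤ k → ∀ Y Y' : PBond P i → Matrix (Fin N) (Fin N) ℂ, Dseg i k (fun b => Y b - Y' b) = fun c => Dseg i k Y c - Dseg i k Y' c)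
    (hseg : ∀ i, i ≤ k → ∀ (Y : PBond P i → Matrix (Fin N) (Fin N) ℂ) (s : ℝ), (∀ b, ‖Y b‖ ≤ s) → ∀ c, ‖Dseg i k Y c‖ ≤ Λ * (P.L : ℝ) ^ (k - i) * s)
    (hsegsucc : ∀ i, i < k → ∀ Y, Dseg i k Y = Dseg (i + 1) k (Ds i Y)) (hsegkk : ∀ Y, Dseg k k Y = Y)
    (hr : ∀ i, i < k → ∀ c, ‖X (i + 1) c - Ds i (X i) c‖ ≤ r (i + 1))
    {M₀ : ℝ} (hX0 : ∀ b, ‖X 0 b‖ ≤ M₀) (c : PBond P k) :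
    ‖X k c‖ ≤ Λ * (P.L : ℝ) ^ k * M₀ + ∑ i ∈ Finset.range k, Λ * (P.L : ℝ) ^ (k - 1 - i) * r (i + 1) := by
  have hlin := hseg 0 (Nat.zero_le k) (X 0) M₀ hX0 c
  rw [Nat.sub_zero] at hlin
  have hrem := norm_sub_segment_le k X Ds Dseg Λ r hsegadd hseg hsegsucc hsegkk hr c
  calc ‖X k c‖ = ‖Dseg 0 k (X 0) c + (X k c - Dseg 0 k (X 0) c)‖ := by rw [add_sub_cancel]
    _ ≤ ‖Dseg 0 k (X 0) c‖ + ‖X k c - Dseg 0 k (X 0) c‖ := norm_add_le _ _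
    _ ≤ _ := add_le_add hlin hrem

/-! ## §2 The same at every level `l ≤ k` (segment letters for every top `l`) -/

/-- ★★ **THE SIZE PROFILE, EVERY LEVEL**: with the segment letters for every top `l ≤ k`, `‖X l c‖ ≤ Λ·L^l·M₀ + Σ_{i<l} Λ·L^{l−1−i}·r(i+1)` for all `l ≤ k`.
[cite: Balaban1985Averaging, Prop. 4 (130)-(131) p.37] -/
theorem norm_le_of_segment_letters_all (k : ℕ) (X : (i : ℕ) → PBond P i → Matrix (Fin N) (Fin N) ℂ)
    (Ds : (i : ℕ) → (PBond P i → Matrix (Fin N) (Fin N) ℂ) → (PBond P (i + 1) → Matrix (Fin N) (Fin N) ℂ))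
    (Dseg : (i k : ℕ) → (PBond P i → Matrix (Fin N) (Fin N) ℂ) → (PBond P k → Matrix (Fin N) (Fin N) ℂ))
    (Λ : ℝ) (r : ℕ → ℝ)
    (hsegadd : ∀ l, l ≤ k → ∀ i, i ≤ l → ∀ Y Y' : PBond P i → Matrix (Fin N) (Fin N) ℂ, Dseg i l (fun b => Y b - Y' b) = fun c => Dseg i l Y c - Dseg i l Y' c)
    (hseg : ∀ l, l ≤ k → ∀ i, i ≤ l → ∀ (Y : PBond P i → Matrix (Fin N) (Fin N) ℂ) (s : ℝ), (∀ b, ‖Y b‖ ≤ s) → ∀ c, ‖Dseg i l Y c‖ ≤ Λ * (P.L : ℝ) ^ (l - i) * s)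
    (hsegsucc : ∀ l, l ≤ k → ∀ i, i < l → ∀ Y, Dseg i l Y = Dseg (i + 1) l (Ds i Y)) (hsegkk : ∀ l Y, Dseg l l Y = Y)
    (hr : ∀ i, i < k → ∀ c, ‖X (i + 1) c - Ds i (X i) c‖ ≤ r (i + 1))
    {M₀ : ℝ} (hX0 : ∀ b, ‖X 0 b‖ ≤ M₀) :
    ∀ l, l ≤ k → ∀ c : PBond P l, ‖X l c‖ ≤ Λ * (P.L : ℝ) ^ l * M₀ + ∑ i ∈ Finset.range l, Λ * (P.L : ℝ) ^ (l - 1 - i) * r (i + 1) :=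
  fun l hl c => norm_top_le_of_segment_letters l X Ds Dseg Λ r (hsegadd l hl) (hseg l hl) (hsegsucc l hl) (hsegkk l)
    (fun i hi => hr i (lt_of_lt_of_le hi hl)) hX0 c

/-! ## §3 The (130)-form bootstrap: a quadratic one-step remainder and ONE top-level smallness give `‖X l‖ ≤ 2Λ·L^l·‖X 0‖` -/

/-- The geometric sum behind the bootstrap: `(L − 1)·Σ_{i<l} L^{l−1−i}·L^{2i} ≤ L^l·L^l` (`L ≥ 1`; step: `L·L^{2l} + (L−1)·L^{2l} ≤ L²·L^{2l}`). [folklore] -/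
theorem geom_bootstrap_sum (L : ℝ) (hL : 1 ≤ L) :
    ∀ l : ℕ, (L - 1) * ∑ i ∈ Finset.range l, L ^ (l - 1 - i) * L ^ (2 * i) ≤ L ^ l * L ^ l
  | 0 => by simp
  | l + 1 => by
    have hL0 : 0 ≤ L := by linarith
    rw [Finset.sum_range_succ, show l + 1 - 1 - l = 0 by omega, pow_zero, one_mul]
    have hrw : ∑ i ∈ Finset.range l, L ^ (l + 1 - 1 - i) * L ^ (2 * i) = L * ∑ i ∈ Finset.range l, L ^ (l - 1 - i) * L ^ (2 * i) := by
      rw [Finset.mul_sum]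
      refine Finset.sum_congr rfl fun i hi => ?_
      have hi' := Finset.mem_range.mp hi
      rw [← mul_assoc, ← pow_succ']
      congr 2
      omega
    rw [hrw, mul_add, ← mul_assoc, mul_comm (L - 1) L, mul_assoc]
    have ih := geom_bootstrap_sum L hL l
    have h1 : L * ((L - 1) * ∑ i ∈ Finset.range l, L ^ (l - 1 - i) * L ^ (2 * i)) ≤ L * (L ^ l * L ^ l) :=
      mul_le_mul_of_nonneg_left ih hL0
    have e2 : L * (L ^ l * L ^ l) = L * L ^ (2 * l) := by ring
    have e : L ^ (l + 1) * L ^ (l + 1) = L ^ 2 * L ^ (2 * l) := by ring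
    rw [e2] at h1
    rw [e]
    have hpos : 0 ≤ L ^ (2 * l) := pow_nonneg hL0 _
    nlinarith [h1, hpos, mul_nonneg (sq_nonneg (L - 1)) hpos]

/-- ★★★ **THE (130)-FORM BOOTSTRAP, K-UNIFORM**: if the one-step remainder is quadratic in the tower's own size
(`‖X (i+1) c − Ds i (X i) c‖ ≤ C₂·s²` whenever `‖X i‖ ≤ s`), the segment rows hold for every top `l ≤ k` with a constant `Λ ≥ 1`, and the TOP-level
smallness `4·Λ²·C₂·L^k·M₀ ≤ L − 1` holds (`M₀ ≥ ‖X 0‖`), then `‖X l c‖ ≤ 2·Λ·L^l·M₀` for EVERY `l ≤ k` — the constant `2Λ` does not depend on the number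
of levels ([Balaban1985Averaging] Prop. 4 (130) «`|Q_j(U₀, A)| ≤ 2Lʲ|A|`»). [cite: Balaban1985Averaging, Prop. 4 (130)-(131) p.37] -/
theorem norm_le_two_mul_of_quadratic_remainder (k : ℕ) (X : (i : ℕ) → PBond P i → Matrix (Fin N) (Fin N) ℂ)
    (Ds : (i : ℕ) → (PBond P i → Matrix (Fin N) (Fin N) ℂ) → (PBond P (i + 1) → Matrix (Fin N) (Fin N) ℂ))
    (Dseg : (i k : ℕ) → (PBond P i → Matrix (Fin N) (Fin N) ℂ) → (PBond P k → Matrix (Fin N) (Fin N) ℂ))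
    {Λ C₂ M₀ : ℝ} (hΛ : 1 ≤ Λ) (hC₂ : 0 ≤ C₂) (hM₀ : 0 ≤ M₀) (hL : 1 < (P.L : ℝ))
    (hsegadd : ∀ l, l ≤ k → ∀ i, i ≤ l → ∀ Y Y' : PBond P i → Matrix (Fin N) (Fin N) ℂ, Dseg i l (fun b => Y b - Y' b) = fun c => Dseg i l Y c - Dseg i l Y' c)
    (hseg : ∀ l, l ≤ k → ∀ i, i ≤ l → ∀ (Y : PBond P i → Matrix (Fin N) (Fin N) ℂ) (s : ℝ), (∀ b, ‖Y b‖ ≤ s) → ∀ c, ‖Dseg i l Y c‖ ≤ Λ * (P.L : ℝ) ^ (l - i) * s)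
    (hsegsucc : ∀ l, l ≤ k → ∀ i, i < l → ∀ Y, Dseg i l Y = Dseg (i + 1) l (Ds i Y)) (hsegkk : ∀ l Y, Dseg l l Y = Y)
    (hr2 : ∀ i, i < k → ∀ s : ℝ, (∀ b, ‖X i b‖ ≤ s) → ∀ c, ‖X (i + 1) c - Ds i (X i) c‖ ≤ C₂ * s ^ 2)
    (hX0 : ∀ b, ‖X 0 b‖ ≤ M₀) (hsmall : 4 * Λ ^ 2 * C₂ * (P.L : ℝ) ^ k * M₀ ≤ (P.L : ℝ) - 1) :
    ∀ l, l ≤ k → ∀ c : PBond P l, ‖X l c‖ ≤ 2 * Λ * (P.L : ℝ) ^ l * M₀ := by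
  -- strong induction on the level
  intro l
  induction l using Nat.strong_induction_on with
  | _ l ih =>
    intro hl c
    have hL0 : (0 : ℝ) ≤ (P.L : ℝ) := by linarith
    have hL1 : (1 : ℝ) ≤ (P.L : ℝ) := hL.le
    have hΛ0 : 0 ≤ Λ := by linarith
    -- the remainder profile from the induction hypothesis
    have hr : ∀ i, i < l → ∀ c, ‖X (i + 1) c - Ds i (X i) c‖ ≤ (fun n => C₂ * (2 * Λ * (P.L : ℝ) ^ (n - 1) * M₀) ^ 2) (i + 1) := by
      intro i hi c'
      have hb := ih i hi (by omega)
      have := hr2 i (by omega) (2 * Λ * (P.L : ℝ) ^ i * M₀) hb c'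
      simpa [Nat.add_sub_cancel] using this
    have htop := norm_top_le_of_segment_letters l X Ds Dseg Λ (fun n => C₂ * (2 * Λ * (P.L : ℝ) ^ (n - 1) * M₀) ^ 2)
      (hsegadd l hl) (hseg l hl) (hsegsucc l hl) (hsegkk l) hr hX0 c
    refine htop.trans ?_
    -- the sum: Σ_{i<l} Λ·L^{l−1−i}·C₂·(2Λ L^i M₀)² = 4Λ³C₂M₀²·Σ L^{l−1−i}·L^{2i} ≤ 4Λ³C₂M₀²·L^l·L^l∕(L−1)
    have hsum : ∑ i ∈ Finset.range l, Λ * (P.L : ℝ) ^ (l - 1 - i) * (fun n => C₂ * (2 * Λ * (P.L : ℝ) ^ (n - 1) * M₀) ^ 2) (i + 1) =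
        4 * Λ ^ 3 * C₂ * M₀ ^ 2 * ∑ i ∈ Finset.range l, (P.L : ℝ) ^ (l - 1 - i) * (P.L : ℝ) ^ (2 * i) := by
      rw [Finset.mul_sum]
      refine Finset.sum_congr rfl fun i _ => ?_
      simp only [Nat.add_sub_cancel]
      ring
    rw [hsum]
    have hgeom := geom_bootstrap_sum (P.L : ℝ) hL1 l
    have hLm1 : 0 < (P.L : ℝ) - 1 := by linarith
    -- (L−1)·S ≤ L^l·L^l ⇒ 4Λ³C₂M₀²·S ≤ 4Λ³C₂M₀²·L^l·L^l∕(L−1) ≤ Λ·L^l·M₀ by the smallness (L^l ≤ L^k)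
    have hS : ∑ i ∈ Finset.range l, (P.L : ℝ) ^ (l - 1 - i) * (P.L : ℝ) ^ (2 * i) ≤ (P.L : ℝ) ^ l * (P.L : ℝ) ^ l / ((P.L : ℝ) - 1) := by
      rw [le_div_iff₀ hLm1]; linarith
    have hlk : (P.L : ℝ) ^ l ≤ (P.L : ℝ) ^ k := pow_le_pow_right₀ hL1 hl
    have hkey : 4 * Λ ^ 3 * C₂ * M₀ ^ 2 * ((P.L : ℝ) ^ l * (P.L : ℝ) ^ l / ((P.L : ℝ) - 1)) ≤ Λ * (P.L : ℝ) ^ l * M₀ := by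
      -- = Λ·L^l·M₀ · (4Λ²C₂·L^l·M₀∕(L−1)) and the bracket is ≤ 1
      have hfrac : 4 * Λ ^ 2 * C₂ * (P.L : ℝ) ^ l * M₀ / ((P.L : ℝ) - 1) ≤ 1 := by
        rw [div_le_one hLm1]
        calc 4 * Λ ^ 2 * C₂ * (P.L : ℝ) ^ l * M₀ ≤ 4 * Λ ^ 2 * C₂ * (P.L : ℝ) ^ k * M₀ := by gcongr
          _ ≤ _ := hsmall
      have hbase : 0 ≤ Λ * (P.L : ℝ) ^ l * M₀ := by positivity
      calc 4 * Λ ^ 3 * C₂ * M₀ ^ 2 * ((P.L : ℝ) ^ l * (P.L : ℝ) ^ l / ((P.L : ℝ) - 1))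
          = (Λ * (P.L : ℝ) ^ l * M₀) * (4 * Λ ^ 2 * C₂ * (P.L : ℝ) ^ l * M₀ / ((P.L : ℝ) - 1)) := by ring
        _ ≤ (Λ * (P.L : ℝ) ^ l * M₀) * 1 := mul_le_mul_of_nonneg_left hfrac hbase
        _ = Λ * (P.L : ℝ) ^ l * M₀ := mul_one _
    have hcoef : 0 ≤ 4 * Λ ^ 3 * C₂ * M₀ ^ 2 := by positivity
    calc Λ * (P.L : ℝ) ^ l * M₀ + 4 * Λ ^ 3 * C₂ * M₀ ^ 2 * ∑ i ∈ Finset.range l, (P.L : ℝ) ^ (l - 1 - i) * (P.L : ℝ) ^ (2 * i)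
        ≤ Λ * (P.L : ℝ) ^ l * M₀ + 4 * Λ ^ 3 * C₂ * M₀ ^ 2 * ((P.L : ℝ) ^ l * (P.L : ℝ) ^ l / ((P.L : ℝ) - 1)) :=
          add_le_add le_rfl (mul_le_mul_of_nonneg_left hS hcoef)
      _ ≤ Λ * (P.L : ℝ) ^ l * M₀ + Λ * (P.L : ℝ) ^ l * M₀ := add_le_add le_rfl hkey
      _ = 2 * Λ * (P.L : ℝ) ^ l * M₀ := by ring

end Summit.QuantumFields.YangMills.Theorems.FluctuationComparisonRegPrIntLS2BetaRelativeSizeProfile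

end
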